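import Summits.ResolutionOfSingularities.ResolutionOfSingularities.Theorems.WildQuotientsSummitReductionStubPairQuasiSplitBaseChangeLemmas3
import Literature.AlgebraicGeometry.Resolution.AlterationsSemiStable
import Literature.AlgebraicGeometry.Resolution.AlterationsFormalCoordinates
import Literature.AlgebraicGeometry.Resolution.AdicQuotient
import HarnessLib

/-!
# `WildQuotients.SummitReduction` (stmt-ResolutionOfSingularities-16324), line `FramePerfect`:
# a quasi-split point gives ordinary double points in the geometric fibres
# (stub `stub_pair_orbitBlowupCentreLocal`, file 7: (H4) ⇒ (H2) at the non-smooth points)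

Route `ResolutionOfSingularities/WildQuotients`, crux `SummitReduction`; helper file of stub
`stub_pair_orbitBlowupCentreLocal` (C2: de Jong 1996, 3.4 Claim (ii) over the orbit centre) of the
line skeleton (v8). Clause (H2) of the stub asks that the closed points over the centre of the
GEOMETRIC fibres of `π ≫ f` be nonsingular points of curves or ordinary double points; at a point
`x'` where the quasi-split datum of clause (H4) holds — `(𝒪_{X₁,x'}/𝔪_y𝒪_{X₁,x'})^ ≅ κ(y)⟦u, v⟧/(uv)`
compatibly with `κ(y)` — every point `x̄'` of a geometric fibre `X₁ ×_Y Spec K` over `x'` is an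
ordinary double point (`IsOrdinaryDoublePoint K x̄'`: `𝒪̂ ≅ K⟦u, v⟧/(uv)`). This is PROVED here
(`isOrdinaryDoublePoint_of_quasiSplitDatum`) from the base-change transfer of the quasi-split datum
of stub QS (`exists_adicCompletion_equiv_of_affineChart`, `…QuasiSplitBaseChangeLemmas3`: the datum
passes to every point of an affine chart of a fibre product `X ×_Y Y'`), applied with `Y' = Spec K`:
the base stalk is then the field `K`, whose maximal ideal is `0`, so the "fibre local ring" of the
base change at `x̄'` is the whole local ring `𝒪_{x̄'}` and its completion is `K⟦u, v⟧/(uv)`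
("a rational singular point with rational tangents stays so under extension of the residue field",
de Jong 1997, pp. 614–615).
-/

set_option linter.dupNamespace false

noncomputable section

open CategoryTheory CategoryTheory.Limits AlgebraicGeometry TopologicalSpace TensorProduct
open Literature.AlgebraicGeometry.Resolution
open IsLocalRing

namespace Summit.ResolutionOfSingularities.ResolutionOfSingularities.Theorems

/-- The stalk of `Spec K`, `K` a field, at any point is a field. [folklore] -/
theorem isField_stalk_spec_field (K : Type) [Field K] (p : Spec (.of K)) :
    IsField ((Spec (.of K)).presheaf.stalk p) := by
  have hp : p = closedPoint K := Subsingleton.elim _ _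
  subst hp
  exact MulEquiv.isField (Field.toIsField K)
    (stalkClosedPointIso (.of K)).commRingCatIsoToRingEquiv.toMulEquiv

/-- For a local ring `R` which is a field, `R/𝔪 ≅ R`. [folklore] -/
theorem exists_ringEquiv_quotient_maximalIdeal_of_isField {R : Type} [CommRing R] [IsLocalRing R]
    (hR : IsField R) : Nonempty ((R ⧸ maximalIdeal R) ≃+* R) :=
  ⟨(Ideal.quotEquivOfEq (isField_iff_maximalIdeal_eq.mp hR)).trans (RingEquiv.quotientBot R)⟩

/-- Killing the zero ideal does not change the completion: `((O/J)^) ≅ Ô` for `J = 0`. [folklore] -/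
theorem nonempty_adicCompletion_quotient_equiv_of_eq_bot {O : Type} [CommRing O] [IsLocalRing O]
    (J : Ideal O) (hJ : J = ⊥) :
    Nonempty (AdicCompletion ((maximalIdeal O).map (Ideal.Quotient.mk J)) (O ⧸ J) ≃+*
      AdicCompletion (maximalIdeal O) O) := by
  subst hJ
  refine ⟨adicCompletionCongr _ _ (RingEquiv.quotientBot O) ?_⟩
  rw [Ideal.map_map]
  convert Ideal.map_id (maximalIdeal O)
  exact RingHom.ext fun x => RingEquiv.quotientBot_mk x

/-- A ring isomorphism of coefficient rings induces one of the formal nodes `k⟦u, v⟧/(uv)`.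
[folklore] -/
theorem nonempty_nodeQuot_equiv_of_ringEquiv {k K : Type} [CommRing k] [CommRing K] (e : k ≃+* K) :
    Nonempty ((MvPowerSeries (Fin 2) k ⧸
        Ideal.span {(MvPowerSeries.X 0 * MvPowerSeries.X 1 : MvPowerSeries (Fin 2) k)}) ≃+*
      (MvPowerSeries (Fin 2) K ⧸
        Ideal.span {(MvPowerSeries.X 0 * MvPowerSeries.X 1 : MvPowerSeries (Fin 2) K)})) :=
  ⟨Ideal.quotientEquiv _ _ (MvPowerSeries.mapRingEquiv (σ := Fin 2) e) (by
    rw [Ideal.map_span, Set.image_singleton, RingHom.coe_coe, map_mul, MvPowerSeries.mapRingEquiv_X,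
      MvPowerSeries.mapRingEquiv_X])⟩

/-- The stalk of `Spec K`, `K` a field, modulo its maximal ideal is `K`. [folklore] -/
theorem nonempty_ringEquiv_quotient_stalk_spec_field (K : Type) [Field K] (p : Spec (.of K)) :
    Nonempty ((((Spec (.of K)).presheaf.stalk p) ⧸ maximalIdeal ((Spec (.of K)).presheaf.stalk p)) ≃+* K) := by
  have hp : p = closedPoint K := Subsingleton.elim _ _
  subst hp
  obtain ⟨qR⟩ := exists_ringEquiv_quotient_maximalIdeal_of_isField (isField_stalk_spec_field K (closedPoint K))
  exact ⟨qR.trans (stalkClosedPointIso (.of K)).commRingCatIsoToRingEquiv⟩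

/-- **A quasi-split point gives ordinary double points in the geometric fibres.** Let `g : X → Y`
(`X` locally Noetherian), `s̄ : Spec K → Y` a field-valued point and `x̄'` a point of `X ×_Y Spec K`
over `x'`. If the completed fibre local ring at `x'` is the formal node over `κ(g x')`,
`(𝒪_{X,x'}/𝔪_{g x'}𝒪_{X,x'})^ ≅ κ(g x')⟦u, v⟧/(uv)` compatibly with `κ(g x')`, then
`𝒪̂_{X ×_Y Spec K, x̄'} ≅ K⟦u, v⟧/(uv)`. [cite: DeJong1997, 5.7 and pp. 614–615] -/
theorem isOrdinaryDoublePoint_of_quasiSplitDatum {X Y : Scheme.{0}} [IsLocallyNoetherian X] (g : X ⟶ Y)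
    (K : Type) [Field K] (s : Spec (.of K) ⟶ Y) (xbar : ↥(pullback g s))
    (ex : AdicCompletion
            ((maximalIdeal (X.presheaf.stalk (pullback.fst g s xbar))).map (Ideal.Quotient.mk
              ((maximalIdeal (Y.presheaf.stalk (g (pullback.fst g s xbar)))).map
                (g.stalkMap (pullback.fst g s xbar)).hom)))
            (X.presheaf.stalk (pullback.fst g s xbar) ⧸
              (maximalIdeal (Y.presheaf.stalk (g (pullback.fst g s xbar)))).map
                (g.stalkMap (pullback.fst g s xbar)).hom) ≃+*
          MvPowerSeries (Fin 2) (Y.presheaf.stalk (g (pullback.fst g s xbar)) ⧸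
              maximalIdeal (Y.presheaf.stalk (g (pullback.fst g s xbar)))) ⧸
            Ideal.span {(MvPowerSeries.X 0 * MvPowerSeries.X 1 :
              MvPowerSeries (Fin 2) (Y.presheaf.stalk (g (pullback.fst g s xbar)) ⧸
                maximalIdeal (Y.presheaf.stalk (g (pullback.fst g s xbar)))))})
    (hex : ex.toRingHom.comp ((algebraMap (X.presheaf.stalk (pullback.fst g s xbar) ⧸
              (maximalIdeal (Y.presheaf.stalk (g (pullback.fst g s xbar)))).map
                (g.stalkMap (pullback.fst g s xbar)).hom) _).comp
            (Ideal.quotientMap ((maximalIdeal (Y.presheaf.stalk (g (pullback.fst g s xbar)))).map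
              (g.stalkMap (pullback.fst g s xbar)).hom)
              (g.stalkMap (pullback.fst g s xbar)).hom Ideal.le_comap_map)) =
          algebraMap (Y.presheaf.stalk (g (pullback.fst g s xbar)) ⧸
            maximalIdeal (Y.presheaf.stalk (g (pullback.fst g s xbar)))) _) :
    IsOrdinaryDoublePoint K xbar := by
  classical
  -- affine charts: `V ∋ g x'` in `Y`, `U ∋ x'` in `X` over `V`, and `⊤` of `Spec K`
  obtain ⟨_, ⟨V, hV, rfl⟩, hyV, -⟩ := Y.isBasis_affineOpens.exists_subset_of_mem_open
    (Set.mem_univ (g (pullback.fst g s xbar))) isOpen_univ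
  obtain ⟨_, ⟨U, hU, rfl⟩, hxU, hUV⟩ := X.isBasis_affineOpens.exists_subset_of_mem_open
    (show pullback.fst g s xbar ∈ g ⁻¹ᵁ V from hyV) (g ⁻¹ᵁ V).isOpen
  have hsV : s (pullback.snd g s xbar) ∈ V := by
    rw [← Scheme.Hom.comp_apply, ← pullback.condition, Scheme.Hom.comp_apply]
    exact hyV
  have hV'V : (⊤ : (Spec (.of K)).Opens) ≤ s ⁻¹ᵁ V := by
    rw [Scheme.preimage_eq_top_of_closedPoint_mem s (by
      rwa [show closedPoint K = pullback.snd g s xbar from Subsingleton.elim _ _])]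
  letI : Algebra Γ(Y, V) Γ(X, U) := (g.appLE V U hUV).hom.toAlgebra
  letI : Algebra Γ(Y, V) Γ(Spec (.of K), ⊤) := (s.appLE V ⊤ hV'V).hom.toAlgebra
  obtain ⟨χ, t, hχ, ht, hS1, hS2⟩ := exists_affineChart_pullback g s hV hU hUV (isAffineOpen_top _) hV'V
    rfl rfl xbar hxU (by trivial)
  haveI := hχ
  subst ht
  -- the quasi-split datum passes to `χ t` over the base `Spec K`
  obtain ⟨e', -⟩ := exists_adicCompletion_equiv_of_affineChart (pullback.fst g s) (pullback.snd g s) g s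
    pullback.condition hU hUV (isAffineOpen_top _) hV'V rfl rfl χ t hS1 hS2 ex hex
  -- the base stalk is the field `K`: its maximal ideal is `0`, so `J = 𝔪_K 𝒪 = 0`
  have hm : maximalIdeal ((Spec (.of K)).presheaf.stalk (pullback.snd g s (χ t))) = ⊥ := isField_iff_maximalIdeal_eq.mp (isField_stalk_spec_field K _)
  have hJ : ((maximalIdeal ((Spec (.of K)).presheaf.stalk (pullback.snd g s (χ t)))).map ((pullback.snd g s).stalkMap (χ t)).hom) = ⊥ := by
    rw [hm, Ideal.map_bot]
  obtain ⟨c₀⟩ := nonempty_adicCompletion_quotient_equiv_of_eq_bot _ hJ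
  obtain ⟨eK⟩ := nonempty_ringEquiv_quotient_stalk_spec_field K (pullback.snd g s (χ t))
  obtain ⟨c₁⟩ := nonempty_nodeQuot_equiv_of_ringEquiv eK
  exact ⟨c₀.symm.trans (e'.trans c₁)⟩

end Summit.ResolutionOfSingularities.ResolutionOfSingularities.Theorems

end
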